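import Literature.Probability.LatticeModels.DisorderedXYModel
import Mathlib.MeasureTheory.Integral.Pi
import Mathlib.MeasureTheory.Integral.Prod
import Mathlib.Analysis.Calculus.ParametricIntegral
import HarnessLib

/-!
# The Nishimori line of the phase-disordered XY model and the gauge (factorisation) identity

C. Garban, T. Spencer, *Continuous symmetry breaking along the Nishimori line*, J. Math. Phys.
**63** (2022) 093302 = arXiv:2109.01617, Definitions 1–2 and Lemma 2.1 (`h = 0`).

The *Nishimori disorder* at inverse temperature `β` draws the bond phases `u = (u_a)_a` of the
XY model `exp (β ∑_a Re (u_a θ̄_{src a} θ_{tgt a})) ∏ dθ` independently from the von Mises law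
`ρ_β(du) = e^{β Re u} du / Z_{ρ_β}` on `U(1)` — the disorder strength is tied to the temperature
(`u ≡ β` in the source's two-parameter family).  The *averaged quenched* expectation is
`𝔼_β[⟨·⟩_{u,β}]`.  **Lemma 2.1** (gauge factorisation; here for `h = 0`, the case used for
Theorem 1.3): under the averaged quenched measure the bond variables
`Y_a = u_a θ̄_{src a} θ_{tgt a}` are themselves i.i.d. with law `ρ_β`:

  `𝔼_β[⟨F(Y)⟩_{u,β}] = 𝔼_β[F(u)]`   for every continuous `F : U(1)^ι → ℂ`

(`nishimoriAvg_cexpect_bondVar`).  The proof is the printed one: the joint change of variables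
`θ ↦ θφ⁻¹`, `u ↦ u · Y(φ, 1)` (a gauge transformation) leaves `⟨F(Y)⟩_u` invariant and moves the
disorder density to `∏_a e^{β Re Y_a(φ,u)}`; averaging over `φ` (Haar probability) produces exactly
the partition function `Z_u`, which cancels the normalisation of `⟨·⟩_u`; the remaining double
integral factorises after the translation `u ↦ u · Y(θ,1)⁻¹` (all changes of variables are translations of the
tori `U(1)^V`, `U(1)^ι`, i.e. invariance of Haar measure, and the interchanges are Fubini for
continuous integrands on compact groups).

## References

* C. Garban, T. Spencer, J. Math. Phys. 63 (2022) 093302, arXiv:2109.01617: Def. 1 (1.3)–(1.4),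
  Def. 2, Lemma 2.1 with its proof (2.1)–(2.4), pp. 4 and 8 of the arXiv version.
  [GarbanSpencer2022]
* H. Nishimori, Prog. Theor. Phys. 66 (1981) 1169–1181 (the gauge transformation, Ising case;
  cited through [GarbanSpencer2022]).
-/

noncomputable section

open MeasureTheory Finset TopologicalSpace
open scoped BigOperators ComplexConjugate

namespace Literature.Probability.LatticeModels

variable [MeasurableSpace Circle] [BorelSpace Circle]

/-! ### The von Mises law on `U(1)` and the Nishimori disorder -/

/-- The von Mises weight `e^{β Re z} = e^{β cos ω}` on `U(1)` (`z = e^{iω}`), the unnormalised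
density of one Nishimori bond phase (Garban–Spencer 2022, Def. 1, `ρ_u` with `u = β`).
[cite: GarbanSpencer2022, Definition 1] -/
def vonMisesWeight (β : ℝ) (z : Circle) : ℝ :=
  Real.exp (β * (z : ℂ).re)

omit [MeasurableSpace Circle] [BorelSpace Circle] in
/-- The von Mises weight is positive. [folklore] -/
theorem vonMisesWeight_pos (β : ℝ) (z : Circle) : 0 < vonMisesWeight β z := Real.exp_pos _

omit [MeasurableSpace Circle] [BorelSpace Circle] in
/-- The von Mises weight is continuous. [folklore] -/
theorem continuous_vonMisesWeight (β : ℝ) : Continuous (vonMisesWeight β) :=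
  Real.continuous_exp.comp (continuous_const.mul (Complex.continuous_re.comp continuous_subtype_val))

/-- The von Mises normalisation `Z_{ρ_β} = ∫ e^{β Re z} dz` (Haar probability `dz` on `U(1)`;
`= I₀(β)`, see `VonMisesMoments`). [cite: GarbanSpencer2022, Definition 1] -/
def vonMisesZ (β : ℝ) : ℝ :=
  ∫ z, vonMisesWeight β z ∂Measure.haarMeasure (⊤ : PositiveCompacts Circle)

/-- `Z_{ρ_β} > 0`. [folklore] -/
theorem vonMisesZ_pos (β : ℝ) : 0 < vonMisesZ β :=
  integral_exp_pos (integrable_of_continuous_compactSpace _ (continuous_vonMisesWeight β))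

variable {ι : Type*} [Fintype ι]

/-- The density (w.r.t. the Haar probability of `U(1)^ι`) of the **Nishimori disorder** at inverse
temperature `β`: independent von Mises phases, `∏_a e^{β Re u_a} / Z_{ρ_β}`
(Garban–Spencer 2022, Def. 1 with Def. 2, `u ≡ β`). [cite: GarbanSpencer2022, Definitions 1 and 2] -/
def nishimoriDensity (β : ℝ) (u : ι → Circle) : ℝ :=
  ∏ a, vonMisesWeight β (u a) / vonMisesZ β

/-- The Nishimori density is positive. [folklore] -/
theorem nishimoriDensity_pos (β : ℝ) (u : ι → Circle) : 0 < nishimoriDensity β u :=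
  Finset.prod_pos fun a _ => div_pos (vonMisesWeight_pos β (u a)) (vonMisesZ_pos β)

/-- The Nishimori density is continuous. [folklore] -/
theorem continuous_nishimoriDensity (β : ℝ) : Continuous (nishimoriDensity (ι := ι) β) :=
  continuous_finsetProd _ fun a _ =>
    ((continuous_vonMisesWeight β).comp (continuous_apply a)).div_const _

/-- The Nishimori density has total mass one. [folklore] -/
theorem integral_nishimoriDensity (β : ℝ) : ∫ u, nishimoriDensity β u ∂torusHaar ι = 1 := by
  unfold nishimoriDensity torusHaar
  rw [integral_fintype_prod_eq_prod (𝕜 := ℝ) (fun (_ : ι) (z : Circle) => vonMisesWeight β z / vonMisesZ β)]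
  refine Finset.prod_eq_one fun a _ => ?_
  rw [integral_div]
  exact div_self (vonMisesZ_pos β).ne'

/-- The **averaged quenched expectation** on the Nishimori line, `𝔼^{XY}_β[Φ(u)] =
∫ Φ(u) ∏_a ρ_β(du_a)`, of a disorder functional `Φ` (typically `Φ(u) = ⟨f⟩_{u,β}` or
`⟨f⟩_{u,β} · R(u)`) (Garban–Spencer 2022, Def. 2). [cite: GarbanSpencer2022, Definition 2] -/
def nishimoriAvg {E : Type*} [NormedAddCommGroup E] [NormedSpace ℝ E] (β : ℝ)
    (Φ : (ι → Circle) → E) : E :=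
  ∫ u, nishimoriDensity β u • Φ u ∂torusHaar ι

/-- `𝔼_β[1] = 1`. [folklore] -/
theorem nishimoriAvg_const_one (β : ℝ) : nishimoriAvg (ι := ι) β (fun _ => (1 : ℝ)) = 1 := by
  simp only [nishimoriAvg, smul_eq_mul, mul_one, integral_nishimoriDensity]

/-- Monotonicity of the disorder average for real functionals: `Φ ≤ Ψ` pointwise (both continuous)
implies `𝔼_β[Φ] ≤ 𝔼_β[Ψ]`. [folklore] -/
theorem nishimoriAvg_mono (β : ℝ) {Φ Ψ : (ι → Circle) → ℝ} (hΦ : Continuous Φ) (hΨ : Continuous Ψ)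
    (h : ∀ u, Φ u ≤ Ψ u) : nishimoriAvg β Φ ≤ nishimoriAvg β Ψ := by
  unfold nishimoriAvg
  refine integral_mono (integrable_torusHaar_of_continuous ((continuous_nishimoriDensity β).smul hΦ))
    (integrable_torusHaar_of_continuous ((continuous_nishimoriDensity β).smul hΨ)) fun u => ?_
  exact smul_le_smul_of_nonneg_left (h u) (nishimoriDensity_pos β u).le

/-- A pointwise bound `Φ ≤ c` gives `𝔼_β[Φ] ≤ c`. [folklore] -/
theorem nishimoriAvg_le_const (β : ℝ) {Φ : (ι → Circle) → ℝ} (hΦ : Continuous Φ) {c : ℝ}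
    (h : ∀ u, Φ u ≤ c) : nishimoriAvg β Φ ≤ c := by
  have := nishimoriAvg_mono β hΦ continuous_const h
  have h1 : nishimoriAvg (ι := ι) β (fun _ => c) = c := by
    have := nishimoriAvg_const_one (ι := ι) β
    simp only [nishimoriAvg, smul_eq_mul, mul_one] at this
    simp only [nishimoriAvg, smul_eq_mul, integral_mul_const, this, one_mul]
  rwa [h1] at this

/-! ### Elementary calculus of the disorder average -/

section Calculus

variable {E : Type*} [NormedAddCommGroup E] [NormedSpace ℝ E]

/-- The disorder average of a constant. [folklore] -/
theorem nishimoriAvg_const [CompleteSpace E] (β : ℝ) (c : E) : nishimoriAvg (ι := ι) β (fun _ => c) = c := by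
  unfold nishimoriAvg
  rw [integral_smul_const, integral_nishimoriDensity, one_smul]

/-- Integrability of `D • Φ` for continuous `Φ`. [folklore] -/
theorem integrable_nishimoriDensity_smul (β : ℝ) {Φ : (ι → Circle) → E} (hΦ : Continuous Φ) :
    Integrable (fun u => nishimoriDensity β u • Φ u) (torusHaar ι) :=
  integrable_torusHaar_of_continuous ((continuous_nishimoriDensity β).smul hΦ)

/-- Additivity of the disorder average (continuous functionals). [folklore] -/
theorem nishimoriAvg_add (β : ℝ) {Φ Ψ : (ι → Circle) → E} (hΦ : Continuous Φ) (hΨ : Continuous Ψ) :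
    nishimoriAvg β (fun u => Φ u + Ψ u) = nishimoriAvg β Φ + nishimoriAvg β Ψ := by
  unfold nishimoriAvg
  simp_rw [smul_add]
  exact integral_add (integrable_nishimoriDensity_smul β hΦ) (integrable_nishimoriDensity_smul β hΨ)

/-- The disorder average of a difference (continuous functionals). [folklore] -/
theorem nishimoriAvg_sub (β : ℝ) {Φ Ψ : (ι → Circle) → E} (hΦ : Continuous Φ) (hΨ : Continuous Ψ) :
    nishimoriAvg β (fun u => Φ u - Ψ u) = nishimoriAvg β Φ - nishimoriAvg β Ψ := by
  unfold nishimoriAvg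
  simp_rw [smul_sub]
  exact integral_sub (integrable_nishimoriDensity_smul β hΦ) (integrable_nishimoriDensity_smul β hΨ)

/-- The disorder average of a finite sum (continuous functionals). [folklore] -/
theorem nishimoriAvg_finset_sum (β : ℝ) {α : Type*} (s : Finset α) {Φ : α → (ι → Circle) → E}
    (hΦ : ∀ i ∈ s, Continuous (Φ i)) :
    nishimoriAvg β (fun u => ∑ i ∈ s, Φ i u) = ∑ i ∈ s, nishimoriAvg β (Φ i) := by
  unfold nishimoriAvg
  simp_rw [Finset.smul_sum]
  exact integral_finsetSum s fun i hi => integrable_nishimoriDensity_smul β (hΦ i hi)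

/-- Constants factor out of the disorder average: `𝔼_β[c Φ] = c 𝔼_β[Φ]`. [folklore] -/
theorem nishimoriAvg_const_mul (β : ℝ) (c : ℂ) (Φ : (ι → Circle) → ℂ) :
    nishimoriAvg β (fun u => c * Φ u) = c * nishimoriAvg β Φ := by
  unfold nishimoriAvg
  rw [← integral_const_mul]
  refine integral_congr_ae (ae_of_all _ fun u => ?_)
  simp only [Complex.real_smul]
  ring

/-- Constants factor out of the disorder average: `𝔼_β[Φ c] = 𝔼_β[Φ] c`. [folklore] -/
theorem nishimoriAvg_mul_const (β : ℝ) (Φ : (ι → Circle) → ℂ) (c : ℂ) :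
    nishimoriAvg β (fun u => Φ u * c) = nishimoriAvg β Φ * c := by
  simp_rw [mul_comm _ c]; exact nishimoriAvg_const_mul β c Φ

/-- Real scalars factor out of the disorder average. [folklore] -/
theorem nishimoriAvg_const_mul_real (β : ℝ) (c : ℝ) (Φ : (ι → Circle) → ℝ) :
    nishimoriAvg β (fun u => c * Φ u) = c * nishimoriAvg β Φ := by
  unfold nishimoriAvg
  rw [← integral_const_mul]
  refine integral_congr_ae (ae_of_all _ fun u => ?_)
  simp only [smul_eq_mul]
  ring

/-- The real part of a disorder average is the average of the real part. [folklore] -/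
theorem re_nishimoriAvg (β : ℝ) {Φ : (ι → Circle) → ℂ} (hΦ : Continuous Φ) :
    (nishimoriAvg β Φ).re = nishimoriAvg β (fun u => (Φ u).re) := by
  unfold nishimoriAvg
  have h := integral_re (integrable_nishimoriDensity_smul β hΦ)
  simp only [RCLike.re_to_complex] at h
  rw [← h]
  refine integral_congr_ae (ae_of_all _ fun u => ?_)
  simp [Complex.real_smul]

/-- **Triangle inequality for the disorder average**: `‖𝔼_β[Φ]‖ ≤ 𝔼_β[‖Φ‖]`. [folklore] -/
theorem norm_nishimoriAvg_le (β : ℝ) (Φ : (ι → Circle) → E) :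
    ‖nishimoriAvg β Φ‖ ≤ nishimoriAvg β (fun u => ‖Φ u‖) := by
  unfold nishimoriAvg
  refine (norm_integral_le_integral_norm _).trans_eq ?_
  refine integral_congr_ae (ae_of_all _ fun u => ?_)
  dsimp only
  rw [norm_smul, Real.norm_of_nonneg (nishimoriDensity_pos β u).le, smul_eq_mul]

/-- **Jensen / Cauchy–Schwarz for the disorder average**: `𝔼_β[g]² ≤ 𝔼_β[g²]` for a continuous
real functional (from `𝔼_β[(g − 𝔼_β g)²] ≥ 0`). [folklore] -/
theorem nishimoriAvg_sq_le (β : ℝ) {g : (ι → Circle) → ℝ} (hg : Continuous g) :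
    nishimoriAvg β g ^ 2 ≤ nishimoriAvg β (fun u => g u ^ 2) := by
  set m := nishimoriAvg β g with hm
  have h0 : 0 ≤ nishimoriAvg β (fun u => (g u - m) ^ 2) := by
    unfold nishimoriAvg
    exact integral_nonneg fun u => smul_nonneg (nishimoriDensity_pos β u).le (sq_nonneg _)
  have hexp : nishimoriAvg β (fun u => (g u - m) ^ 2) =
      nishimoriAvg β (fun u => g u ^ 2) - 2 * m * nishimoriAvg β g + m ^ 2 := by
    have e : (fun u => (g u - m) ^ 2) = fun u => (g u ^ 2 - (2 * m) * g u) + m ^ 2 := by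
      funext u; ring
    have h1 := nishimoriAvg_add β (Φ := fun u => g u ^ 2 - (2 * m) * g u) (Ψ := fun _ => m ^ 2)
      ((hg.pow 2).sub (continuous_const.mul hg)) continuous_const
    have h2 := nishimoriAvg_sub β (Φ := fun u => g u ^ 2) (Ψ := fun u => (2 * m) * g u)
      (hg.pow 2) (continuous_const.mul hg)
    have h3 := nishimoriAvg_const_mul_real (ι := ι) β (2 * m) g
    have h4 := nishimoriAvg_const (ι := ι) β (m ^ 2)
    rw [e, h1, h2, h3, h4]
  rw [hexp, ← hm] at h0
  nlinarith [h0]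

end Calculus

/-! ### Continuity of quenched expectations in the disorder -/

section Parametric

variable {V : Type*} [Fintype V]

/-- A parametric torus integral `u ↦ ∫ g(u, θ) dθ` of a jointly continuous integrand is
continuous. [folklore] -/
theorem continuous_integral_torusHaar {E : Type*} [NormedAddCommGroup E] [NormedSpace ℝ E]
    {g : (ι → Circle) → (V → Circle) → E} (hg : Continuous (Function.uncurry g)) :
    Continuous fun u => ∫ θ, g u θ ∂torusHaar V := by
  have h := continuous_parametric_integral_of_continuous (μ := torusHaar V) hg isCompact_univ
  simpa only [Measure.restrict_univ] using h

end Parametric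

namespace BondSystem

variable {V : Type*} [Fintype V] (G : BondSystem V ι)

/-- The partition function `Z_{u,β}` is continuous in the phases `u`. [folklore] -/
theorem continuous_partitionFn (β : ℝ) : Continuous (G.partitionFn β) :=
  continuous_integral_torusHaar (G.continuous_weight_uncurry β)

/-- The quenched expectation `u ↦ ⟨F(u, ·)⟩_{u,β}` of a jointly continuous observable is
continuous in the phases. [folklore] -/
theorem continuous_cexpect (β : ℝ) {F : (ι → Circle) → (V → Circle) → ℂ}
    (hF : Continuous (Function.uncurry F)) : Continuous fun u => G.cexpect β u (F u) := by
  have h1 : Continuous fun u => ∫ θ, F u θ * (G.weight β u θ : ℂ) ∂torusHaar V :=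
    continuous_integral_torusHaar (g := fun u θ => F u θ * (G.weight β u θ : ℂ))
      (hF.mul (Complex.continuous_ofReal.comp (G.continuous_weight_uncurry β)))
  have h2 : Continuous fun u => (G.partitionFn β u : ℂ) :=
    Complex.continuous_ofReal.comp (G.continuous_partitionFn β)
  exact h1.div h2 fun u => by exact_mod_cast (G.partitionFn_pos β u).ne'

/-! ### Lemma 2.1: the gauge identity -/

omit [Fintype V] in
/-- The gauge-shifted Nishimori density is the Gibbs weight:
`∏_a ρ_β(u_a · φ̄_{src a} φ_{tgt a}) = exp (β ∑_a Re Y_a(φ, u)) / Z_ρ^{|ι|}`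
(Garban–Spencer 2022, proof of Lemma 2.1, the numerator after (2.3)). [cite: GarbanSpencer2022, proof of Lemma 2.1, (2.3)] -/
theorem nishimoriDensity_mul_bondVar_one (β : ℝ) (u : ι → Circle) (φ : V → Circle) :
    nishimoriDensity β (u * G.bondVar 1 φ) = G.weight β u φ / vonMisesZ β ^ Fintype.card ι := by
  unfold nishimoriDensity weight energy
  rw [Finset.prod_div_distrib, Finset.prod_const, Finset.card_univ, Finset.mul_sum, Real.exp_sum]
  congr 1
  refine Finset.prod_congr rfl fun a _ => ?_
  simp only [vonMisesWeight, bondVar, Pi.mul_apply, Pi.one_apply, one_mul, mul_assoc]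

/-- Averaging the gauge-shifted density over the gauge group gives the partition function:
`∫ ∏_a ρ_β(u_a φ̄_{src a} φ_{tgt a}) dφ = Z_{u,β} / Z_ρ^{|ι|}` — the cancellation at the heart of
the Nishimori line (Garban–Spencer 2022, proof of Lemma 2.1: "the numerator … cancels
`Z_{ω,ψ,β,h,Λ}`"). [cite: GarbanSpencer2022, proof of Lemma 2.1, (2.3)–(2.4)] -/
theorem integral_nishimoriDensity_mul_bondVar_one (β : ℝ) (u : ι → Circle) :
    ∫ φ, nishimoriDensity β (u * G.bondVar 1 φ) ∂torusHaar V =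
      G.partitionFn β u / vonMisesZ β ^ Fintype.card ι := by
  simp only [nishimoriDensity_mul_bondVar_one, integral_div, partitionFn]

/-- **Step 1 of Lemma 2.1 (gauge invariance of the quenched expectation of bond-variable
observables):** `⟨F(Y)⟩_{u · Y(φ,1)} = ⟨F(Y)⟩_u` (change of variables `θ ↦ θφ⁻¹`, (2.2) of the
source). [cite: GarbanSpencer2022, proof of Lemma 2.1, (2.2)] -/
theorem cexpect_bondVar_gauge (β : ℝ) (u : ι → Circle) (φ : V → Circle) (F : (ι → Circle) → ℂ) :
    G.cexpect β (u * G.bondVar 1 φ) (fun θ => F (G.bondVar (u * G.bondVar 1 φ) θ)) =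
      G.cexpect β u (fun θ => F (G.bondVar u θ)) := by
  rw [cexpect_mul_bondVar_one]
  simp only [bondVar_mul_bondVar_one, inv_mul_cancel_right]

/-- **Garban–Spencer 2022, Lemma 2.1 (`h = 0`): factorisation on the Nishimori line.** For every
finite bond system, every `β` and every continuous `F : U(1)^ι → ℂ`,
`𝔼^{XY}_β[⟨F((u_a θ̄_{src a} θ_{tgt a})_a)⟩_{u,β}] = 𝔼_β[F(u)]`: under the averaged quenched
measure the bond variables `Y_a = e^{i(θ(tgt a) − θ(src a) + ω_a)}` are independent with the
disorder's own law `ρ_β` ("The right side is independent of" the spins' interaction).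
[cite: GarbanSpencer2022, Lemma 2.1] -/
theorem nishimoriAvg_cexpect_bondVar (β : ℝ) {F : (ι → Circle) → ℂ} (hF : Continuous F) :
    nishimoriAvg β (fun u => G.cexpect β u (fun θ => F (G.bondVar u θ))) = nishimoriAvg β F := by
  -- notation
  set Ex : (ι → Circle) → ℂ := fun u => G.cexpect β u (fun θ => F (G.bondVar u θ)) with hEx
  have hFY : Continuous (Function.uncurry fun (u : ι → Circle) (θ : V → Circle) => F (G.bondVar u θ)) :=
    hF.comp (continuous_pi fun a => G.continuous_bondVar_uncurry a)
  have hExc : Continuous Ex := G.continuous_cexpect β hFY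
  have hD := continuous_nishimoriDensity (ι := ι) β
  have hZρ : (0 : ℝ) < vonMisesZ β ^ Fintype.card ι := pow_pos (vonMisesZ_pos β) _
  have hZρC : ((vonMisesZ β ^ Fintype.card ι : ℝ) : ℂ) ≠ 0 := by exact_mod_cast hZρ.ne'
  have hZρ1 : (vonMisesZ β : ℂ) ≠ 0 := by exact_mod_cast (vonMisesZ_pos β).ne'
  -- Step 1: for every gauge `φ`, move the density: 𝔼[Ex] = ∫ Ex(u) D(u·Y(φ,1)) du
  have step1 : ∀ φ : V → Circle, nishimoriAvg β Ex =
      ∫ u, (nishimoriDensity β (u * G.bondVar 1 φ) : ℂ) * Ex u ∂torusHaar ι := by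
    intro φ
    unfold nishimoriAvg
    rw [← integral_torusHaar_mul_right (fun u => nishimoriDensity β u • Ex u) (G.bondVar 1 φ)]
    refine integral_congr_ae (ae_of_all _ fun u => ?_)
    simp only [Complex.real_smul, hEx]
    rw [cexpect_bondVar_gauge]
  -- Step 2: average Step 1 over `φ` and swap the integrals
  have step2 : nishimoriAvg β Ex =
      ∫ u, (∫ φ, (nishimoriDensity β (u * G.bondVar 1 φ) : ℂ) ∂torusHaar V) * Ex u ∂torusHaar ι := by
    have hc : Continuous (Function.uncurry fun (φ : V → Circle) (u : ι → Circle) =>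
        (nishimoriDensity β (u * G.bondVar 1 φ) : ℂ) * Ex u) := by
      refine (Complex.continuous_ofReal.comp (hD.comp ?_)).mul (hExc.comp continuous_snd)
      exact continuous_snd.mul (continuous_pi fun a =>
        (G.continuous_bondVar_uncurry a).comp (continuous_const.prodMk continuous_fst))
    calc nishimoriAvg β Ex = ∫ _φ : V → Circle, nishimoriAvg β Ex ∂torusHaar V := by
          simp only [integral_const, probReal_univ, one_smul]
      _ = ∫ φ, ∫ u, (nishimoriDensity β (u * G.bondVar 1 φ) : ℂ) * Ex u ∂torusHaar ι ∂torusHaar V :=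
          integral_congr_ae (ae_of_all _ fun φ => step1 φ)
      _ = ∫ u, ∫ φ, (nishimoriDensity β (u * G.bondVar 1 φ) : ℂ) * Ex u ∂torusHaar V ∂torusHaar ι :=
          integral_integral_swap
            (integrable_of_continuous_of_isFiniteMeasure ((torusHaar V).prod (torusHaar ι)) hc)
      _ = _ := by
          refine integral_congr_ae (ae_of_all _ fun u => ?_)
          exact integral_mul_const _ _
  -- Step 3: the `φ`-average of the shifted density is `Z_u / Z_ρ^{|ι|}`, which cancels `Z_u`
  have step3 : nishimoriAvg β Ex = (∫ u, ∫ θ, F (G.bondVar u θ) * G.weight β u θ ∂torusHaar V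
      ∂torusHaar ι) / (vonMisesZ β ^ Fintype.card ι : ℝ) := by
    rw [step2, eq_div_iff hZρC, ← integral_mul_const]
    refine integral_congr_ae (ae_of_all _ fun u => ?_)
    dsimp only
    have hZuC : (G.partitionFn β u : ℂ) ≠ 0 := by exact_mod_cast (G.partitionFn_pos β u).ne'
    rw [integral_complex_ofReal, integral_nishimoriDensity_mul_bondVar_one, hEx]
    dsimp only [cexpect]
    push_cast
    field_simp
  -- Step 4: swap, and freeze the bond variables by `u ↦ u · Y(θ,1)⁻¹`
  have step4 : ∫ u, ∫ θ, F (G.bondVar u θ) * G.weight β u θ ∂torusHaar V ∂torusHaar ι =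
      ∫ u, F u * (∏ a, vonMisesWeight β (u a) : ℝ) ∂torusHaar ι := by
    have hc : Continuous (Function.uncurry fun (u : ι → Circle) (θ : V → Circle) =>
        F (G.bondVar u θ) * (G.weight β u θ : ℂ)) :=
      hFY.mul (Complex.continuous_ofReal.comp (G.continuous_weight_uncurry β))
    refine (integral_integral_swap
      (integrable_of_continuous_of_isFiniteMeasure ((torusHaar ι).prod (torusHaar V)) hc)).trans ?_
    calc ∫ θ, ∫ u, F (G.bondVar u θ) * (G.weight β u θ : ℂ) ∂torusHaar ι ∂torusHaar V
        = ∫ _θ : V → Circle, ∫ u, F u * (∏ a, vonMisesWeight β (u a) : ℝ) ∂torusHaar ι ∂torusHaar V := by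
          refine integral_congr_ae (ae_of_all _ fun θ => ?_)
          dsimp only
          rw [← integral_torusHaar_mul_right _ (G.bondVar 1 θ)⁻¹]
          refine integral_congr_ae (ae_of_all _ fun u => ?_)
          dsimp only
          simp only [weight, energy, Finset.mul_sum, Real.exp_sum, vonMisesWeight]
          rw [G.bondVar_mul_inv_bondVar_one u θ]
      _ = _ := by simp only [integral_const, probReal_univ, one_smul]
  -- conclusion
  rw [step3, step4]
  unfold nishimoriAvg nishimoriDensity
  rw [div_eq_iff hZρC, ← integral_mul_const]
  refine integral_congr_ae (ae_of_all _ fun u => ?_)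
  dsimp only
  rw [Complex.real_smul, Finset.prod_div_distrib, Finset.prod_const, Finset.card_univ]
  push_cast
  field_simp

/-- **Independence of the phases (product formula)**: `𝔼_β[∏_a g_a(u_a)] = ∏_a ρ_β[g_a]`.
[cite: GarbanSpencer2022, Definition 1 (independence over the edges)] -/
theorem _root_.Literature.Probability.LatticeModels.nishimoriAvg_prod (β : ℝ) (g : ι → Circle → ℂ) :
    nishimoriAvg β (fun u : ι → Circle => ∏ a, g a (u a)) =
      ∏ a, ∫ z, (vonMisesWeight β z / vonMisesZ β : ℝ) * g a z
        ∂Measure.haarMeasure (⊤ : PositiveCompacts Circle) := by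
  unfold nishimoriAvg nishimoriDensity torusHaar
  have : ∀ u : ι → Circle, (∏ a, vonMisesWeight β (u a) / vonMisesZ β : ℝ) • ∏ a, g a (u a) =
      ∏ a, (((vonMisesWeight β (u a) / vonMisesZ β : ℝ) : ℂ) * g a (u a)) := fun u => by
    rw [Complex.real_smul, Complex.ofReal_prod, ← Finset.prod_mul_distrib]
  simp_rw [this]
  exact integral_fintype_prod_eq_prod (𝕜 := ℂ)
    (fun (a : ι) (z : Circle) => ((vonMisesWeight β z / vonMisesZ β : ℝ) : ℂ) * g a z)

end BondSystem

end Literature.Probability.LatticeModels
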